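import Literature.AnabelianGeometry.AbsoluteAnabelian.AutHolomorphicSpacesTransportProofs
import HarnessLib

/-!
# Anti-holomorphy in charts from a local anti-Möbius factorisation (PROOF-ONLY support for Prop. 2.2)

For Riemann surfaces `X`, `Y`, a map `φ : X → Y`, a holomorphic disc coordinate `E : X → unitDiscOpens`
near `y` and a holomorphic disc parametrisation `S : unitDiscOpens → Y`: if, near `y`, `φ` factors as
`S ∘ R ∘ conj ∘ E` with `R` holomorphic on the ball, then `conj ∘ (chart expression of φ at y)` is
`ℂ`-differentiable, i.e. `φ` is anti-holomorphic at `y` in the sense of [AbsTopIII] Def. 2.1.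
This is the chart-level half of the Prop. 2.2 (i) transport (`AutHolomorphicSpacesDiscProofs`),
separated so that the disc-picture files can use it without the normaliser theorem.

[cite: MochizukiAbsTopIII2015, Proposition 2.2 (i) p.52]
-/

noncomputable section

namespace Literature.AnabelianGeometry.AbsoluteAnabelian

open _root_.TopologicalSpace _root_.Topology _root_.Set _root_.Metric _root_.Function _root_.Filter
open scoped _root_.Manifold _root_.ContDiff ComplexConjugate
open Literature.Analysis.Complex

/-! ### Anti-holomorphy in charts from a local anti-Möbius factorisation -/

section AntiHol

variable {X Y : Type*} [TopologicalSpace X] [ChartedSpace ℂ X] [IsManifold 𝓘(ℂ, ℂ) ω X]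
  [TopologicalSpace Y] [ChartedSpace ℂ Y] [IsManifold 𝓘(ℂ, ℂ) ω Y]

/-- Complex conjugation preserves the ball. [cite: MochizukiAbsTopIII2015, Definition 2.1 (ii) p.51] -/
theorem conj_mem_unitBall {z : ℂ} (hz : z ∈ ball (0 : ℂ) 1) : conj z ∈ ball (0 : ℂ) 1 := by
  rwa [mem_ball_zero_iff, Complex.norm_conj, ← mem_ball_zero_iff]

/-- **Anti-holomorphic charts from a local factorisation.**  If near `y` the map `φ : X → Y`
factors as `φ p = S (q_p)` with `q_p ∈ 𝔻` the point `R (conj (E p))`, where `E : X → 𝔻` is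
`ℂ`-differentiable at `y`, `S : 𝔻 → Y` is `ℂ`-differentiable and `R` is holomorphic on the ball
and maps it into itself, then the conjugate of the expression of `φ` in the preferred charts at `y`
is `ℂ`-differentiable at the base point — `φ` is anti-holomorphic at `y` in the sense of
[AbsTopIII] Def. 2.1 (ii). [cite: MochizukiAbsTopIII2015, Definition 2.1 (ii) p.51] -/
theorem differentiableAt_conj_writtenInExtChartAt_of_eventually (φ : X → Y) (y : X)
    (E : X → unitDiscOpens) (hE : MDifferentiableAt 𝓘(ℂ, ℂ) 𝓘(ℂ, ℂ) E y)
    (S : unitDiscOpens → Y) (hS : MDifferentiable 𝓘(ℂ, ℂ) 𝓘(ℂ, ℂ) S)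
    {R : ℂ → ℂ} (hR : DifferentiableOn ℂ R (ball 0 1)) (hRm : MapsTo R (ball 0 1) (ball 0 1))
    (hloc : ∀ᶠ p in 𝓝 y, φ p = S ⟨R (conj (E p : ℂ)), hRm (conj_mem_unitBall (E p).2)⟩) :
    DifferentiableAt ℂ (conj ∘ writtenInExtChartAt 𝓘(ℂ, ℂ) 𝓘(ℂ, ℂ) y φ) (extChartAt 𝓘(ℂ, ℂ) y y) := by
  set cX := chartAt ℂ y with hcX
  set cY := chartAt ℂ (φ y) with hcY
  set B : ℂ → unitDiscOpens := E ∘ cX.symm with hB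
  set A : unitDiscOpens → ℂ := cY ∘ S with hA
  set Abar : ℂ → ℂ := Function.extend Subtype.val A fun _ => 0 with hAbar
  have hw : extChartAt 𝓘(ℂ, ℂ) y y = cX y := by simp [hcX]
  -- the chart expression, near the base point
  have hnear : ∀ᶠ w in 𝓝 (cX y), (conj ∘ writtenInExtChartAt 𝓘(ℂ, ℂ) 𝓘(ℂ, ℂ) y φ) w =
      ((conj ∘ (Abar ∘ R) ∘ conj) ∘ (Subtype.val ∘ B)) w := by
    have hcont : ContinuousAt cX.symm (cX y) := cX.continuousAt_symm (mem_chart_target ℂ y)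
    have hloc' : ∀ᶠ w in 𝓝 (cX y), φ (cX.symm w) =
        S ⟨R (conj (E (cX.symm w) : ℂ)), hRm (conj_mem_unitBall (E (cX.symm w)).2)⟩ := by
      have h2 : Tendsto cX.symm (𝓝 (cX y)) (𝓝 y) := by
        have := hcont.tendsto
        rwa [cX.left_inv (mem_chart_source ℂ y)] at this
      exact h2.eventually hloc
    filter_upwards [hloc'] with w hw'
    simp only [writtenInExtChartAt, extChartAt_coe, extChartAt_coe_symm, modelWithCornersSelf_coe,
      modelWithCornersSelf_coe_symm, comp_apply, id]
    congr 1
    rw [hw']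
    show cY (S ⟨R (conj (E (cX.symm w) : ℂ)), hRm (conj_mem_unitBall (E (cX.symm w)).2)⟩) =
      Abar (R (conj (E (cX.symm w) : ℂ)))
    rw [hAbar, extend_apply_of_mem _ _ (hRm (conj_mem_unitBall (E (cX.symm w)).2)), hA]
    rfl
  rw [hw]
  refine (Filter.EventuallyEq.differentiableAt_iff hnear).2 ?_
  -- `B` is differentiable at `cX y`
  have hBd : MDifferentiableAt 𝓘(ℂ, ℂ) 𝓘(ℂ, ℂ) B (cX y) := by
    refine MDifferentiableAt.comp _ ?_ (mdifferentiableAt_atlas_symm (chart_mem_atlas ℂ y)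
      (mem_chart_target ℂ y))
    rw [cX.left_inv (mem_chart_source ℂ y)]
    exact hE
  have hBd' : DifferentiableAt ℂ (Subtype.val ∘ B) (cX y) :=
    differentiableAt_val_comp_of_mdifferentiableAt hBd
  refine DifferentiableAt.comp _ ?_ hBd'
  -- `conj ∘ (Abar ∘ R) ∘ conj` is differentiable at `u₀ = E y`
  rw [differentiableAt_conj_conj_iff]
  have hu : (Subtype.val ∘ B) (cX y) = (E y : ℂ) := by
    simp [hB, cX.left_inv (mem_chart_source ℂ y)]
  rw [hu]
  have hcu : conj (E y : ℂ) ∈ ball (0 : ℂ) 1 := conj_mem_unitBall (E y).2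
  have hRd : DifferentiableAt ℂ R (conj (E y : ℂ)) := hR.differentiableAt (isOpen_ball.mem_nhds hcu)
  refine DifferentiableAt.comp _ ?_ hRd
  -- `Abar` is differentiable at `R (conj (E y))`
  set q : unitDiscOpens := ⟨R (conj (E y : ℂ)), hRm hcu⟩ with hq
  have hAd : MDifferentiableAt 𝓘(ℂ, ℂ) 𝓘(ℂ, ℂ) A q := by
    refine MDifferentiableAt.comp _ ?_ (hS q)
    have hy : φ y = S q := hloc.self_of_nhds
    rw [← hy]
    exact mdifferentiableAt_atlas (chart_mem_atlas ℂ (φ y)) (mem_chart_source ℂ (φ y))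
  exact differentiableAt_extend_of_mdifferentiableAt hAd

end AntiHol

end Literature.AnabelianGeometry.AbsoluteAnabelian
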